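import Mathlib
import Literature.MathematicalPhysics.QuantumFieldTheory.Balaban1983to89.B14Sect3

/-!
# `Balaban1983to89.B14.Eq356FieldStrength` — [Balaban1988Convergent] (3.56)–(3.57) p. 281: the lattice FIELD STRENGTH
`F_{κμ}(z) = (∂_κB_μ)(z) − (∂_μB_κ)(z) + i[B_κ(z), B_μ(z)]` and the antisymmetrized form of the second-order term — the
printed objects as definitions with bodies, and (3.56) PROVED (concrete companion of `B14Sect3.sum_antisymm_two_pairs`)

statement-level skeleton of published theorems with citation tags; proofs where landed; nothing here is a
claim about the Yang–Mills mass gap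

PDF held: `paper:balaban1988-cmp119-convergent-renormalization` (journal page = PDF page + 242; (3.49) read on the x2 render
p038, (3.55)–(3.57) on p039 of `run/shared/lean/pub/pub-balaban/b2b-balaban-ref1/pages/1988-cmp119-convergent-renormalization/`).

CITATION HEADER (lean-in-tree rule).  Source: T. Bałaban, *Convergent renormalization expansions for lattice gauge
theories*, Commun. Math. Phys. **119**, 243–285 (1988), doi:10.1007/bf01217741 [Balaban1988Convergent] (cell paper B14 =
"[III]").  Mega-formalization `lit-balaban` (HOME `run/shared/lean/pub/lit-balaban/`), reader/typer unit `lit-balaban-r11`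
(generation 2), SKELETON row **B14.Eq3.55–3.57** (decls of record: `B14Sect3.sum_antisymm_two_pairs`, the ABSTRACT algebraic
skeleton "(3.49) + (3.55) ⇒ (3.56)" for arbitrary coefficient tables `E`, `T`; the displays (3.56)/(3.57) themselves — the
field strength and the trace form — were absent).  This file supplies the printed OBJECTS and instantiates the skeleton.

THE PRINTED TEXT (verbatim, p. 281 [PDF 39]).  *"Denoting by 𝐄^{(2)}_{μν,κλ}(X, z) the sum over x, y in the square bracket
in (3.49), we have  𝐄^{(2)}_{μν,κλ}(X, z) = −𝐄^{(2)}_{κν,μλ}(X, z) = −𝐄^{(2)}_{μλ,κν}(X, z).  (3.55)  This property allows us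
to antisymmetrize the derivatives in (3.49) in the indices μ, κ and ν, λ. Denoting F_{κμ}(z) = (∂_κB_μ)(z) − (∂_μB_κ)(z) +
i[B_κ(z), B_μ(z)], we have
  Σ_{n=1}^{4} (1/n!) ⟨𝐄^{(n)}(X, z), ⊗ⁿB⟩ = Σ_{κ<μ, λ<ν} ½ 𝐄^{(2)}_{μν,κλ}(X, z) tr F_{κμ}(z)F_{λν}(z) + (the irrelevant terms).  (3.56)
… Thus we obtain the identity (3.56) resummed over the domains X, but with the first expression on the right-hand side
replaced by  ½ Σ_{κ<μ, λ<ν} Π^{(j)}_{μν,κλ} tr F_{κμ}(z)F_{λν}(z).  (3.57)  Here Π^{(j)}_{μν,κλ} = Σ_{x,y} Π^{(j)}_{μν}(x, y, z)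
(x_κ − z_κ)(y_λ − z_λ), and the function Π^{(j)}_{μν}(x, y, z) is given by the formula (3.50), but with 𝐄^{(j)}(X, U_j, z)
replaced by 𝐄^{(j)}(U_j, z) defined on the whole lattice L^{−j}Z^d. This function is translation invariant, hence
Π^{(j)}_{μν,κλ} is independent of z."*  And (3.49) p. 280: the second-order term is
*"Σ_{μ,ν,κ,λ} [Σ_{x,y} 𝐄^{(2)}_{μν}(X, x, y, z)(x_κ − z_κ)(y_λ − z_λ)] · ½ tr((∂_κB_μ)(z) + ½i[B_κ(z), B_μ(z)])((∂_λB_ν)(z) +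
½i[B_λ(z), B_ν(z)]) + (the irrelevant terms)"*.

WHAT IS TYPED (everything at a FIXED point `z`; `n` a finite index type, matrices over `ℂ`; `d` the dimension):
* `fieldStrength dB B κ μ := dB κ μ − dB μ κ + i•(B κ·B μ − B μ·B κ)` — (3.56)'s `F_{κμ}(z)`, with `dB κ μ` standing for the
  lattice derivative `(∂_κB_μ)(z)` and `B μ` for `B_μ(z)` (the lattice difference quotient itself is not modelled: ANY family
  `dB` — the identities below are pointwise algebra);
* `halfTerm dB B κ μ := dB κ μ + ½i•[B κ, B μ]` — the matrix `M_{κμ}` inside (3.49);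
* `pairTrace dB B κ μ τ ν := ½ Re tr(M_{κμ} M_{τν})` — the coefficient `½ tr(…)(…)` of (3.49) (real part; for Hermitian
  data the trace is real: `isHermitian_fieldStrength` + the tree's `QuantumLattice.im_trace_mul_of_isHermitian`);
* `expr356 E dB B` — the right-hand side of (3.56) without the irrelevant terms, `Σ_{κ<μ, τ<ν} ½ E_{μν,κτ} Re tr F_{κμ}F_{τν}`
  (indicator form over `univ`, the shape of `B14Sect3.sum_antisymm_two_pairs`); `moment2` — the printed second moment
  `Π_{μν,κλ} = Σ_{x,y} Π_{μν}(x,y,z)(x_κ − z_κ)(y_λ − z_λ)` over a finite window of pairs (the printed sum runs over the whole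
  lattice `L^{−j}Z^d` and converges absolutely by (3.48); a finite window is the typed special case —
  TODO(general form): `tsum` over `L^{−j}ℤ^d`); `expr357 Π dB B := expr356 Π dB B` read with `E := Π` — (3.57).
WHAT IS PROVED: `fieldStrength_swap` (`F_{μκ} = −F_{κμ}`), `fieldStrength_self` (`F_{κκ} = 0`), `halfTerm_sub_swap`
(`M_{κμ} − M_{μκ} = F_{κμ}` — WHY antisymmetrizing (3.49) produces the field strength: the `½i[·,·]` doubles),
`isHermitian_fieldStrength` (Hermitian `B_μ(z)`, `(∂_κB_μ)(z)` ⇒ Hermitian `F_{κμ}(z)`), `pairTrace_bracket`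
(`T_{κμ,τν} − T_{μκ,τν} − T_{κμ,ντ} + T_{μκ,ντ} = ½ Re tr F_{κμ}F_{τν}`, bilinearity of `(P,Q) ↦ ½ tr PQ`), and
**`eq356`** — (3.56) for the second-order term: for every coefficient table `E` with the antisymmetries (3.55),
`Σ_{μ,ν,κ,τ} E_{μν,κτ} · ½ Re tr(M_{κμ}M_{τν}) = Σ_{κ<μ, τ<ν} ½ E_{μν,κτ} Re tr F_{κμ}F_{τν}` (= `expr356 E dB B`), by
`B14Sect3.sum_antisymm_two_pairs` + `pairTrace_bracket`.
NOT HERE: the "irrelevant terms" and their bounds (3.48); the identification of `E` with Bałaban's localized kernels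
𝐄^{(2)}_{μν,κλ}(X, z) and of `Π` with (3.50); the `z`-independence of Π^{(j)} (translation invariance on the infinite
lattice); (3.58)–(3.61) (row B14.Eq3.58–3.61, `B14Sect3.invariant_tensor_361`).  No `sorry`.
-/

open Matrix Finset

namespace Literature.MathematicalPhysics.QuantumFieldTheory.Balaban1983to89.B14.Eq356FieldStrength

variable {d : ℕ} {n : Type*} [Fintype n]

/-- **(3.56), the lattice field strength at a point**: `F_{κμ}(z) = (∂_κB_μ)(z) − (∂_μB_κ)(z) + i[B_κ(z), B_μ(z)]`,
with `dB κ μ = (∂_κB_μ)(z)`, `B μ = B_μ(z)`. [cite: Balaban1988Convergent, (3.56) p.281] -/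
def fieldStrength (dB : Fin d → Fin d → Matrix n n ℂ) (B : Fin d → Matrix n n ℂ) (κ μ : Fin d) : Matrix n n ℂ :=
  dB κ μ - dB μ κ + Complex.I • (B κ * B μ - B μ * B κ)

/-- The matrix `M_{κμ} = (∂_κB_μ)(z) + ½ i[B_κ(z), B_μ(z)]` of the second-order term in (3.49).
[cite: Balaban1988Convergent, (3.49) p.280] -/
noncomputable def halfTerm (dB : Fin d → Fin d → Matrix n n ℂ) (B : Fin d → Matrix n n ℂ) (κ μ : Fin d) : Matrix n n ℂ :=
  dB κ μ + ((1/2 : ℂ) * Complex.I) • (B κ * B μ - B μ * B κ)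

/-- The coefficient `T_{κμ,τν} = ½ tr(M_{κμ} M_{τν})` of (3.49) (real part). [cite: Balaban1988Convergent, (3.49) p.280] -/
noncomputable def pairTrace (dB : Fin d → Fin d → Matrix n n ℂ) (B : Fin d → Matrix n n ℂ) (κ μ τ ν : Fin d) : ℝ :=
  (1/2 : ℝ) * ((halfTerm dB B κ μ * halfTerm dB B τ ν).trace).re

/-- The right-hand side of (3.56) without the irrelevant terms, `Σ_{κ<μ, τ<ν} ½ E_{μν,κτ} tr F_{κμ}(z)F_{τν}(z)` (real part;
indicator form over `univ`). [cite: Balaban1988Convergent, (3.56) p.281] -/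
noncomputable def expr356 (E : Fin d → Fin d → Fin d → Fin d → ℝ) (dB : Fin d → Fin d → Matrix n n ℂ)
    (B : Fin d → Matrix n n ℂ) : ℝ :=
  ∑ μ, ∑ κ, ∑ ν, ∑ τ, (if κ < μ then (if τ < ν then
    E μ ν κ τ * ((1/2 : ℝ) * ((fieldStrength dB B κ μ * fieldStrength dB B τ ν).trace).re) else 0) else 0)

/-- **(3.57)**: `½ Σ_{κ<μ, λ<ν} Π^{(j)}_{μν,κλ} tr F_{κμ}(z)F_{λν}(z)` — (3.56) resummed, the coefficient table now the
`z`-independent moments `Π^{(j)}_{μν,κλ}`. [cite: Balaban1988Convergent, (3.57) p.281] -/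
noncomputable def expr357 (P : Fin d → Fin d → Fin d → Fin d → ℝ) (dB : Fin d → Fin d → Matrix n n ℂ)
    (B : Fin d → Matrix n n ℂ) : ℝ :=
  expr356 P dB B

/-- The second moments of (3.57): `Π_{μν,κλ} = Σ_{x,y} Π_{μν}(x, y, z)(x_κ − z_κ)(y_λ − z_λ)` over a finite window `s` of
pairs `(x, y)` (coordinates `coord`).  TODO(general form): the printed sum is over all of `L^{−j}Z^d` (absolutely convergent
by (3.48)). [cite: Balaban1988Convergent, (3.57) p.281] -/
def moment2 {X : Type*} (s : Finset (X × X)) (P₂ : Fin d → Fin d → X → X → ℝ) (coord : X → Fin d → ℝ) (z : X)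
    (μ ν κ τ : Fin d) : ℝ :=
  ∑ xy ∈ s, P₂ μ ν xy.1 xy.2 * (coord xy.1 κ - coord z κ) * (coord xy.2 τ - coord z τ)

/-- Antisymmetry `F_{μκ}(z) = −F_{κμ}(z)`. [cite: Balaban1988Convergent, (3.56) p.281] -/
theorem fieldStrength_swap (dB : Fin d → Fin d → Matrix n n ℂ) (B : Fin d → Matrix n n ℂ) (κ μ : Fin d) :
    fieldStrength dB B μ κ = -fieldStrength dB B κ μ := by
  unfold fieldStrength
  module

/-- `F_{κκ}(z) = 0`. [cite: Balaban1988Convergent, (3.56) p.281] -/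
theorem fieldStrength_self (dB : Fin d → Fin d → Matrix n n ℂ) (B : Fin d → Matrix n n ℂ) (κ : Fin d) :
    fieldStrength dB B κ κ = 0 := by
  simp [fieldStrength]

/-- **Why antisymmetrization produces the field strength**: `M_{κμ} − M_{μκ} = F_{κμ}` (the `½i[B_κ,B_μ]` of (3.49) doubles
to the `i[B_κ,B_μ]` of (3.56)). [cite: Balaban1988Convergent, (3.49) p.280, (3.56) p.281] -/
theorem halfTerm_sub_swap (dB : Fin d → Fin d → Matrix n n ℂ) (B : Fin d → Matrix n n ℂ) (κ μ : Fin d) :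
    halfTerm dB B κ μ - halfTerm dB B μ κ = fieldStrength dB B κ μ := by
  unfold halfTerm fieldStrength
  module

/-- For Hermitian data (`B_μ(z)`, `(∂_κB_μ)(z)` Hermitian — `B` is `(1/i) log` of unitary bond variables), `F_{κμ}(z)` is
Hermitian, so `tr F_{κμ}F_{λν}` is real. [cite: Balaban1988Convergent, (3.56) p.281] -/
theorem isHermitian_fieldStrength {dB : Fin d → Fin d → Matrix n n ℂ} {B : Fin d → Matrix n n ℂ}
    (hdB : ∀ κ μ, (dB κ μ).IsHermitian) (hB : ∀ μ, (B μ).IsHermitian) (κ μ : Fin d) :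
    (fieldStrength dB B κ μ).IsHermitian := by
  unfold fieldStrength
  refine ((hdB κ μ).sub (hdB μ κ)).add ?_
  unfold Matrix.IsHermitian
  rw [conjTranspose_smul, conjTranspose_sub, conjTranspose_mul, conjTranspose_mul, (hB κ).eq, (hB μ).eq,
    Complex.star_def, Complex.conj_I]
  module

/-- **The bracket identity** (bilinearity of `(P,Q) ↦ ½ tr PQ`):
`T_{κμ,τν} − T_{μκ,τν} − T_{κμ,ντ} + T_{μκ,ντ} = ½ tr F_{κμ}F_{τν}` (real parts). [cite: Balaban1988Convergent, (3.56) p.281] -/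
theorem pairTrace_bracket (dB : Fin d → Fin d → Matrix n n ℂ) (B : Fin d → Matrix n n ℂ) (κ μ τ ν : Fin d) :
    ((pairTrace dB B κ μ τ ν - pairTrace dB B μ κ τ ν) - pairTrace dB B κ μ ν τ) + pairTrace dB B μ κ ν τ =
      (1/2 : ℝ) * ((fieldStrength dB B κ μ * fieldStrength dB B τ ν).trace).re := by
  rw [← halfTerm_sub_swap, ← halfTerm_sub_swap]
  simp only [pairTrace, sub_mul, mul_sub, trace_sub, Complex.sub_re]
  ring

/-- **(3.56)** for the second-order term: for every coefficient table with the antisymmetries (3.55)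
(`E_{μν,κτ} = −E_{κν,μτ} = −E_{μτ,κν}`),
`Σ_{μ,ν,κ,τ} E_{μν,κτ} · ½ tr(M_{κμ}M_{τν}) = Σ_{κ<μ, τ<ν} ½ E_{μν,κτ} tr F_{κμ}(z)F_{τν}(z)` (real parts) — the abstract
skeleton `B14Sect3.sum_antisymm_two_pairs` instantiated with the printed objects. [cite: Balaban1988Convergent, (3.55)–(3.56) p.281] -/
theorem eq356 (E : Fin d → Fin d → Fin d → Fin d → ℝ) (hE₁ : ∀ μ ν κ τ, E μ ν κ τ = -E κ ν μ τ)
    (hE₂ : ∀ μ ν κ τ, E μ ν κ τ = -E μ τ κ ν) (dB : Fin d → Fin d → Matrix n n ℂ) (B : Fin d → Matrix n n ℂ) :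
    ∑ μ, ∑ ν, ∑ κ, ∑ τ, E μ ν κ τ * pairTrace dB B κ μ τ ν = expr356 E dB B := by
  unfold expr356
  rw [B14Sect3.sum_antisymm_two_pairs E (pairTrace dB B) hE₁ hE₂]
  simp only [pairTrace_bracket]

/-- (3.57) is (3.56)'s right-hand side read with the resummed coefficients `Π^{(j)}_{μν,κλ}` (definitional).
[cite: Balaban1988Convergent, (3.57) p.281] -/
theorem expr357_eq (P : Fin d → Fin d → Fin d → Fin d → ℝ) (dB : Fin d → Fin d → Matrix n n ℂ)
    (B : Fin d → Matrix n n ℂ) : expr357 P dB B = expr356 P dB B := rfl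

end Literature.MathematicalPhysics.QuantumFieldTheory.Balaban1983to89.B14.Eq356FieldStrength
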